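import Summits.QuantumFields.BalabanUV.Beta.GAN24.ThreeFaceRecOfLetters

/-!
# `BalabanUV.Beta.GAN24.ThreeFaceRecLiteral` — binder row G-an2-4 ∕ (CONV-C), W-slot CT-W, route «WC-TL», PRICING Q-S3C: **THE D1 LITERAL WITH ITS TABLE INPUT
# REDUCED** — leaf-01 g60's capstone (`SourceBracketCombOfS3c` ∕ `SpureRecLegChargeThreeFace.exists_allScalesSeq_JsRowD1Pin_of_threeFace_C_QD`) re-cut three ways:
# from the two face letters, from the cubic-Wilson face law (T-W)_face alone, and from the ONE finite graded identity (W-face) of an3's table at `d = 3`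

NOT IN PRINT; OUR BOOKKEEPING ([folklore] composition BY NAME of `ThreeFaceRecOfLetters` with `SpureRecLegChargeThreeFace`; G-an2-4 formalisation swarm, leaf prover
`b2b-balaban-gan24-formalise-leaf-04`, gen 62).  HONEST FRAMING (cell contract, verbatim): «discharging `BetaPertH` makes Bałaban's UV stability UNCONDITIONAL — a real
constructive-QFT result; it is NOT the continuum limit and NOT the Clay problem.»  HONEST DEPENDENCY (verbatim): «continuum YM on T⁴ ⇐ BetaPertH ∧ nine spine
estimates (0/9 proved); BetaPertH ⇐ (D1) ∧ (D4) ∧ CAP+tail; G-an2-4 gates asym, D1 and NE2/3/4.»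

WHAT ([folklore]; 0 `def`, 0 cited facts, 0 `def … : Prop`, 0 sorry; d = 3, `Lc` odd ≥ 2, box root `ctrOff`, Bałaban's pins): **`exists_allScalesSeq_JsRowD1Pin_of_faceLetters_C_QD`**
(D1 literal ⟸ {(T-0)_face, (T-H)_face, (C)sym, (Q-D), (Q-D-rate)}), **`exists_allScalesSeq_JsRowD1Pin_of_wilsonFace_C_QD`** (⟸ {(T-W)_face, (C)sym, (Q-D), (Q-D-rate)}),
**`exists_allScalesSeq_JsRowD1Pin_of_gradedWilson_C_QD`** (⟸ {(W-face) at d = 3: `∀ γ α β, Σ_{x,z ∈ box1 4} [cond]·wilsonA 3 γ 0 x z (inl α)(inl β) = 0` — a DECIDABLE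
identity of an3's explicit table, exact in rationals (this lineage's R6) —, (C)sym, (Q-D), (Q-D-rate)}).  CONDITIONAL on the displayed hypotheses; asserts NO value of
Bałaban's tables; discharges NOTHING of (W-face) ∕ (C)sym ∕ (Q-D) ∕ (Q-D-rate) ∕ «T2Shape» ∕ «T2Drift» ∕ (hW, hWall); NOT «D1 closed»; NEVER «G-an2-4 closed» as (CONV-C);
NOT D1, NOT `BetaPertH`, NOT continuum, NOT Clay.  2026-08-22; no existing file touched.
-/

noncomputable section

open Finset
open scoped BigOperators
open Literature.MathematicalPhysics.QuantumFieldTheory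
open Literature.MathematicalPhysics.QuantumFieldTheory.Balaban1983to89
open Literature.MathematicalPhysics.QuantumFieldTheory.Balaban1983to89.Beta
open ExpKernelCalculus (Site MKer)
open AffineAveraging (box toSite)
open OneStepResolventKernel (Fib)
open OneStepKernelFamily (KInvStep TbalOf)
open BalabanStepJetsSucc (lamCoeffK E2)
open InterLevelTransport (SLam)
open AveragingHessianKernelsRooted (hessFFAt)
open Summit.QuantumFields.BalabanUV.Beta.HessKerDressedUnits (unitS)
open Summit.QuantumFields.BalabanUV.Beta.WardLocusRecursive (SrecAt)
open Summit.QuantumFields.BalabanUV.Beta.SpineRooted (SpureRecAt T2RecOf T2RecAt M1At)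
open Summit.QuantumFields.BalabanUV.Beta.SecondOrderUnits (unitS₂)
open Summit.QuantumFields.BalabanUV.Beta.GAN24.CombesThomas (sfStep smStep)
open Summit.QuantumFields.BalabanUV.Beta.GAN24.BiStencilZeroMode (Tab zmode)
open AveragingMixedJetTables (mixFFAt)
open BalabanCompositeJets (LocStencil₂)
open RemainderConstAllScales (AllScalesSeq)
open AveragingContoursRooted (ctrOff ctrOff_mem_box)
open WilsonVertex2Sym (wsym22)
open Summit.QuantumFields.BalabanUV.Beta.AxialDressingRooted (dressKBmAt coProjBmAtK)
open Summit.QuantumFields.BalabanUV.Beta.SecondOrderSocketIdentification (vh₂SAn1)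
open Summit.QuantumFields.BalabanUV.Beta.RowD1JointEnd (JsRowD1Pin)

namespace Summit.QuantumFields.BalabanUV.Beta.GAN24.ThreeFaceRecLiteral

open StepJetData (wilsonA)
open Summit.QuantumFields.BalabanUV.Beta.GAN24.ThreeFaceRecOfLetters (threeFace_rec_Lc_of_letters threeFace_rec_of_wilsonFace)
open Summit.QuantumFields.BalabanUV.Beta.GAN24.SpureRecLegChargeThreeFace (exists_allScalesSeq_JsRowD1Pin_of_threeFace_C_QD)
open BalabanStepJets (box1)

variable {d : ℕ} {Lc : ℕ} [NeZero Lc]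

/-! ## The D1 literal from the two face letters + (C)sym + (Q-D) + (Q-D-rate) -/

section Literal

variable {r : Fin (3 + 1) → ℕ}

/-- NOT IN PRINT; OUR BOOKKEEPING.  **THE D1 LITERAL FROM THE TWO FACE LETTERS, (C)sym, (Q-D), (Q-D-rate)** — leaf-01 g60's capstone re-cut once more:
`SpureRecLegChargeThreeFace.exists_allScalesSeq_JsRowD1Pin_of_threeFace_C_QD` with «3F-REC» replaced by the level-0 face letter (every period) and the Λ-piece
face letter (every level, every period).  CONDITIONAL on its displayed hypotheses; discharges none of them. -/
theorem exists_allScalesSeq_JsRowD1Pin_of_faceLetters_C_QD (hodd : Odd Lc) (hLc : 2 ≤ Lc) (N : ℕ) {cE cVH cΛ cE₂ cB : ℝ}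
    {Tc : Fin 4 → Fin 4 → Fin 4 → Fin 4 → ℝ} {vh₂S : Tab 3}
    (hρ : r = ctrOff (3 + 1) Lc) (hcE : cE = (Lc : ℝ) ^ 4) (hcVH : cVH = -((Lc : ℝ) ^ 8 / 2)) (hcΛ : cΛ = 2 / (Lc : ℝ) ^ 4) (hcE₂ : cE₂ = (Lc : ℝ) ^ 8)
    (hcB : cB = -((Lc : ℝ) ^ 12 / 4)) (hTc : Tc = (8 * (N : ℝ) ^ 2)⁻¹ • wsym22 N) (hvh : vh₂S = vh₂SAn1 Lc)
    (h0 : ∀ (k : ℕ) (γ α β : Fin (3 + 1)),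
      ∑ v ∈ box (3 + 1) (Lc ^ (k + 1)), (if toSite v γ % ((Lc ^ (k + 1) : ℕ) : ℤ) = ((Lc ^ (k + 1) : ℕ) : ℤ) - 1 then (1 : ℝ) else 0) *
          ∑' yw : Site (3 + 1) × Site (3 + 1),
            (if yw.1 α % ((Lc ^ (k + 1) : ℕ) : ℤ) = ((Lc ^ (k + 1) : ℕ) : ℤ) - 1 then (1 : ℝ) else 0) *
              (if yw.2 β % ((Lc ^ (k + 1) : ℕ) : ℤ) = ((Lc ^ (k + 1) : ℕ) : ℤ) - 1 then (1 : ℝ) else 0) *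
              SrecAt 3 Lc (toSite r) cE cVH cΛ 0 γ (toSite v) yw.1 yw.2 (Sum.inl α) (Sum.inl β) = 0)
    (hΛ : ∀ (j : ℕ) (k : ℕ) (γ α β : Fin (3 + 1)),
      ∑ v ∈ box (3 + 1) (Lc ^ (k + 1)), (if toSite v γ % ((Lc ^ (k + 1) : ℕ) : ℤ) = ((Lc ^ (k + 1) : ℕ) : ℤ) - 1 then (1 : ℝ) else 0) *
          ∑' yw : Site (3 + 1) × Site (3 + 1),
            (if yw.1 α % ((Lc ^ (k + 1) : ℕ) : ℤ) = ((Lc ^ (k + 1) : ℕ) : ℤ) - 1 then (1 : ℝ) else 0) *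
              (if yw.2 β % ((Lc ^ (k + 1) : ℕ) : ℤ) = ((Lc ^ (k + 1) : ℕ) : ℤ) - 1 then (1 : ℝ) else 0) *
              SLam Lc (lamCoeffK (KInvStep (d := 3) Lc (j + 1)) (E2 3 Lc (j + 1)) Lc) (fun μ y => hessFFAt (toSite r) Lc μ y)
                γ (toSite v) yw.1 yw.2 (Sum.inl α) (Sum.inl β) = 0)
    {CY δY CY' θY δY' : ℝ}
    (hC : ∀ (i : ℕ) (κ κ' κ₁ κ₂ : Fin (3 + 1)),
      zmode Lc (unitS₂ (sfStep Lc i) (smStep 3 Lc i) (T2RecAt 3 Lc (toSite r) cE cVH cΛ cE₂ cB Tc vh₂S (mixFFAt (toSite r) Lc) i)) κ κ' (Sum.inl κ₁) (Sum.inl κ₂)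
          + zmode Lc (unitS₂ (sfStep Lc i) (smStep 3 Lc i) (T2RecAt 3 Lc (toSite r) cE cVH cΛ cE₂ cB Tc vh₂S (mixFFAt (toSite r) Lc) i)) κ' κ (Sum.inl κ₁) (Sum.inl κ₂)
        = zmode Lc (unitS₂ (sfStep Lc i) (smStep 3 Lc i) (T2RecOf 3 Lc (fun j => KInvStep (d := 3) Lc j) (SpureRecAt 3 Lc (toSite r) cE cVH cΛ) (M1At 3 Lc (toSite r) cΛ) cE₂ cB Tc vh₂S (mixFFAt (toSite r) Lc) i)) κ κ' (Sum.inl κ₁) (Sum.inl κ₂)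
          + zmode Lc (unitS₂ (sfStep Lc i) (smStep 3 Lc i) (T2RecOf 3 Lc (fun j => KInvStep (d := 3) Lc j) (SpureRecAt 3 Lc (toSite r) cE cVH cΛ) (M1At 3 Lc (toSite r) cΛ) cE₂ cB Tc vh₂S (mixFFAt (toSite r) Lc) i)) κ' κ (Sum.inl κ₁) (Sum.inl κ₂))
    (hY : ∀ m : ℕ, LocStencil₂ ((fun κ u κ' u' => dressKBmAt (toSite r) Lc (coProjBmAtK (toSite r) Lc (fun κ₁ u₁ => coProjBmAtK (toSite r) Lc
            ((unitS₂ (sfStep Lc m) (smStep 3 Lc m) (T2RecAt 3 Lc (toSite r) cE cVH cΛ cE₂ cB Tc vh₂S (mixFFAt (toSite r) Lc) m)) κ₁ u₁) κ' u') κ u)) -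
          (unitS₂ (sfStep Lc m) (smStep 3 Lc m) (T2RecAt 3 Lc (toSite r) cE cVH cΛ cE₂ cB Tc vh₂S (mixFFAt (toSite r) Lc) m))) CY δY) (hδY : 0 < δY)
    (hYr : ∀ m : ℕ, LocStencil₂ (((fun κ u κ' u' => dressKBmAt (toSite r) Lc (coProjBmAtK (toSite r) Lc (fun κ₁ u₁ => coProjBmAtK (toSite r) Lc
            ((unitS₂ (sfStep Lc (m + 1)) (smStep 3 Lc (m + 1)) (T2RecAt 3 Lc (toSite r) cE cVH cΛ cE₂ cB Tc vh₂S (mixFFAt (toSite r) Lc) (m + 1))) κ₁ u₁) κ' u') κ u)) -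
          (unitS₂ (sfStep Lc (m + 1)) (smStep 3 Lc (m + 1)) (T2RecAt 3 Lc (toSite r) cE cVH cΛ cE₂ cB Tc vh₂S (mixFFAt (toSite r) Lc) (m + 1)))) -
      ((fun κ u κ' u' => dressKBmAt (toSite r) Lc (coProjBmAtK (toSite r) Lc (fun κ₁ u₁ => coProjBmAtK (toSite r) Lc
            ((unitS₂ (sfStep Lc m) (smStep 3 Lc m) (T2RecAt 3 Lc (toSite r) cE cVH cΛ cE₂ cB Tc vh₂S (mixFFAt (toSite r) Lc) m)) κ₁ u₁) κ' u') κ u)) -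
          (unitS₂ (sfStep Lc m) (smStep 3 Lc m) (T2RecAt 3 Lc (toSite r) cE cVH cΛ cE₂ cB Tc vh₂S (mixFFAt (toSite r) Lc) m)))) (CY' * θY ^ m) δY') (hθY0 : 0 ≤ θY) (hθY1 : θY < 1) (hδY' : 0 < δY') (μ ν : Fin 4) :
    ∃ κ θ : ℝ, 0 ≤ θ ∧ θ < 1 ∧ AllScalesSeq (fun j => B12Beta.secondMoment (TbalOf Lc (JsRowD1Pin hodd N) j) μ ν) κ θ := by
  have hLc1 : 1 ≤ Lc := le_trans (by norm_num) hLc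
  have hr : r ∈ box (3 + 1) Lc := by rw [hρ]; exact ctrOff_mem_box (by omega)
  exact exists_allScalesSeq_JsRowD1Pin_of_threeFace_C_QD hodd hLc N hρ hcE hcVH hcΛ hcE₂ hcB hTc hvh
    (threeFace_rec_Lc_of_letters hLc1 hr cE cVH cΛ h0 hΛ) hC hY hδY hYr hθY0 hθY1 hδY' μ ν


/-- NOT IN PRINT; OUR BOOKKEEPING.  **THE D1 LITERAL FROM THE CUBIC-WILSON FACE LAW (T-W)_face, (C)sym, (Q-D), (Q-D-rate)** — the table input of leaf-01 g60's
capstone reduced to ONE finite letter.  CONDITIONAL on its displayed hypotheses; discharges none of them. -/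
theorem exists_allScalesSeq_JsRowD1Pin_of_wilsonFace_C_QD (hodd : Odd Lc) (hLc : 2 ≤ Lc) (N : ℕ) {cE cVH cΛ cE₂ cB : ℝ}
    {Tc : Fin 4 → Fin 4 → Fin 4 → Fin 4 → ℝ} {vh₂S : Tab 3}
    (hρ : r = ctrOff (3 + 1) Lc) (hcE : cE = (Lc : ℝ) ^ 4) (hcVH : cVH = -((Lc : ℝ) ^ 8 / 2)) (hcΛ : cΛ = 2 / (Lc : ℝ) ^ 4) (hcE₂ : cE₂ = (Lc : ℝ) ^ 8)
    (hcB : cB = -((Lc : ℝ) ^ 12 / 4)) (hTc : Tc = (8 * (N : ℝ) ^ 2)⁻¹ • wsym22 N) (hvh : vh₂S = vh₂SAn1 Lc)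
    (hW : ∀ (k : ℕ) (γ α β : Fin (3 + 1)),
      ∑ v ∈ box (3 + 1) (Lc ^ (k + 1)), (if toSite v γ % ((Lc ^ (k + 1) : ℕ) : ℤ) = ((Lc ^ (k + 1) : ℕ) : ℤ) - 1 then (1 : ℝ) else 0) *
        ∑' yw : Site (3 + 1) × Site (3 + 1),
          (if yw.1 α % ((Lc ^ (k + 1) : ℕ) : ℤ) = ((Lc ^ (k + 1) : ℕ) : ℤ) - 1 then (1 : ℝ) else 0) *
            (if yw.2 β % ((Lc ^ (k + 1) : ℕ) : ℤ) = ((Lc ^ (k + 1) : ℕ) : ℤ) - 1 then (1 : ℝ) else 0) *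
            wilsonA 3 γ (toSite v) yw.1 yw.2 (Sum.inl α) (Sum.inl β) = 0)
    {CY δY CY' θY δY' : ℝ}
    (hC : ∀ (i : ℕ) (κ κ' κ₁ κ₂ : Fin (3 + 1)),
      zmode Lc (unitS₂ (sfStep Lc i) (smStep 3 Lc i) (T2RecAt 3 Lc (toSite r) cE cVH cΛ cE₂ cB Tc vh₂S (mixFFAt (toSite r) Lc) i)) κ κ' (Sum.inl κ₁) (Sum.inl κ₂)
          + zmode Lc (unitS₂ (sfStep Lc i) (smStep 3 Lc i) (T2RecAt 3 Lc (toSite r) cE cVH cΛ cE₂ cB Tc vh₂S (mixFFAt (toSite r) Lc) i)) κ' κ (Sum.inl κ₁) (Sum.inl κ₂)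
        = zmode Lc (unitS₂ (sfStep Lc i) (smStep 3 Lc i) (T2RecOf 3 Lc (fun j => KInvStep (d := 3) Lc j) (SpureRecAt 3 Lc (toSite r) cE cVH cΛ) (M1At 3 Lc (toSite r) cΛ) cE₂ cB Tc vh₂S (mixFFAt (toSite r) Lc) i)) κ κ' (Sum.inl κ₁) (Sum.inl κ₂)
          + zmode Lc (unitS₂ (sfStep Lc i) (smStep 3 Lc i) (T2RecOf 3 Lc (fun j => KInvStep (d := 3) Lc j) (SpureRecAt 3 Lc (toSite r) cE cVH cΛ) (M1At 3 Lc (toSite r) cΛ) cE₂ cB Tc vh₂S (mixFFAt (toSite r) Lc) i)) κ' κ (Sum.inl κ₁) (Sum.inl κ₂))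
    (hY : ∀ m : ℕ, LocStencil₂ ((fun κ u κ' u' => dressKBmAt (toSite r) Lc (coProjBmAtK (toSite r) Lc (fun κ₁ u₁ => coProjBmAtK (toSite r) Lc
            ((unitS₂ (sfStep Lc m) (smStep 3 Lc m) (T2RecAt 3 Lc (toSite r) cE cVH cΛ cE₂ cB Tc vh₂S (mixFFAt (toSite r) Lc) m)) κ₁ u₁) κ' u') κ u)) -
          (unitS₂ (sfStep Lc m) (smStep 3 Lc m) (T2RecAt 3 Lc (toSite r) cE cVH cΛ cE₂ cB Tc vh₂S (mixFFAt (toSite r) Lc) m))) CY δY) (hδY : 0 < δY)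
    (hYr : ∀ m : ℕ, LocStencil₂ (((fun κ u κ' u' => dressKBmAt (toSite r) Lc (coProjBmAtK (toSite r) Lc (fun κ₁ u₁ => coProjBmAtK (toSite r) Lc
            ((unitS₂ (sfStep Lc (m + 1)) (smStep 3 Lc (m + 1)) (T2RecAt 3 Lc (toSite r) cE cVH cΛ cE₂ cB Tc vh₂S (mixFFAt (toSite r) Lc) (m + 1))) κ₁ u₁) κ' u') κ u)) -
          (unitS₂ (sfStep Lc (m + 1)) (smStep 3 Lc (m + 1)) (T2RecAt 3 Lc (toSite r) cE cVH cΛ cE₂ cB Tc vh₂S (mixFFAt (toSite r) Lc) (m + 1)))) -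
      ((fun κ u κ' u' => dressKBmAt (toSite r) Lc (coProjBmAtK (toSite r) Lc (fun κ₁ u₁ => coProjBmAtK (toSite r) Lc
            ((unitS₂ (sfStep Lc m) (smStep 3 Lc m) (T2RecAt 3 Lc (toSite r) cE cVH cΛ cE₂ cB Tc vh₂S (mixFFAt (toSite r) Lc) m)) κ₁ u₁) κ' u') κ u)) -
          (unitS₂ (sfStep Lc m) (smStep 3 Lc m) (T2RecAt 3 Lc (toSite r) cE cVH cΛ cE₂ cB Tc vh₂S (mixFFAt (toSite r) Lc) m)))) (CY' * θY ^ m) δY') (hθY0 : 0 ≤ θY) (hθY1 : θY < 1) (hδY' : 0 < δY') (μ ν : Fin 4) :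
    ∃ κ θ : ℝ, 0 ≤ θ ∧ θ < 1 ∧ AllScalesSeq (fun j => B12Beta.secondMoment (TbalOf Lc (JsRowD1Pin hodd N) j) μ ν) κ θ := by
  have hLc1 : 1 ≤ Lc := le_trans (by norm_num) hLc
  have hr : r ∈ box (3 + 1) Lc := by rw [hρ]; exact ctrOff_mem_box (by omega)
  exact exists_allScalesSeq_JsRowD1Pin_of_threeFace_C_QD hodd hLc N hρ hcE hcVH hcΛ hcE₂ hcB hTc hvh
    (fun j γ α β => by
      have h := threeFace_rec_of_wilsonFace hLc1 hr cE cVH cΛ hW j 0 γ α β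
      simpa only [zero_add, pow_one] using h) hC hY hδY hYr hθY0 hθY1 hδY' μ ν


/-- NOT IN PRINT; OUR BOOKKEEPING.  **THE D1 LITERAL FROM THE FINITE GRADED WILSON IDENTITY (W-face) AT `d = 3`, (C)sym, (Q-D), (Q-D-rate)** — the table input of
leaf-01 g60's capstone reduced to ONE DECIDABLE identity of an3's cubic Wilson table.  CONDITIONAL on its displayed hypotheses; discharges none of them. -/
theorem exists_allScalesSeq_JsRowD1Pin_of_gradedWilson_C_QD (hodd : Odd Lc) (hLc : 2 ≤ Lc) (N : ℕ) {cE cVH cΛ cE₂ cB : ℝ}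
    {Tc : Fin 4 → Fin 4 → Fin 4 → Fin 4 → ℝ} {vh₂S : Tab 3}
    (hρ : r = ctrOff (3 + 1) Lc) (hcE : cE = (Lc : ℝ) ^ 4) (hcVH : cVH = -((Lc : ℝ) ^ 8 / 2)) (hcΛ : cΛ = 2 / (Lc : ℝ) ^ 4) (hcE₂ : cE₂ = (Lc : ℝ) ^ 8)
    (hcB : cB = -((Lc : ℝ) ^ 12 / 4)) (hTc : Tc = (8 * (N : ℝ) ^ 2)⁻¹ • wsym22 N) (hvh : vh₂S = vh₂SAn1 Lc)
    (hG : ∀ (γ α β : Fin (3 + 1)), ∑ x ∈ box1 (3 + 1), ∑ z ∈ box1 (3 + 1),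
      (if ((α = γ → x α = 0) ∧ (β = γ → z β = 0) ∧ (α = β → α ≠ γ → x α = z β)) then
        wilsonA 3 γ 0 x z (Sum.inl α) (Sum.inl β) else 0) = 0)
    {CY δY CY' θY δY' : ℝ}
    (hC : ∀ (i : ℕ) (κ κ' κ₁ κ₂ : Fin (3 + 1)),
      zmode Lc (unitS₂ (sfStep Lc i) (smStep 3 Lc i) (T2RecAt 3 Lc (toSite r) cE cVH cΛ cE₂ cB Tc vh₂S (mixFFAt (toSite r) Lc) i)) κ κ' (Sum.inl κ₁) (Sum.inl κ₂)
          + zmode Lc (unitS₂ (sfStep Lc i) (smStep 3 Lc i) (T2RecAt 3 Lc (toSite r) cE cVH cΛ cE₂ cB Tc vh₂S (mixFFAt (toSite r) Lc) i)) κ' κ (Sum.inl κ₁) (Sum.inl κ₂)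
        = zmode Lc (unitS₂ (sfStep Lc i) (smStep 3 Lc i) (T2RecOf 3 Lc (fun j => KInvStep (d := 3) Lc j) (SpureRecAt 3 Lc (toSite r) cE cVH cΛ) (M1At 3 Lc (toSite r) cΛ) cE₂ cB Tc vh₂S (mixFFAt (toSite r) Lc) i)) κ κ' (Sum.inl κ₁) (Sum.inl κ₂)
          + zmode Lc (unitS₂ (sfStep Lc i) (smStep 3 Lc i) (T2RecOf 3 Lc (fun j => KInvStep (d := 3) Lc j) (SpureRecAt 3 Lc (toSite r) cE cVH cΛ) (M1At 3 Lc (toSite r) cΛ) cE₂ cB Tc vh₂S (mixFFAt (toSite r) Lc) i)) κ' κ (Sum.inl κ₁) (Sum.inl κ₂))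
    (hY : ∀ m : ℕ, LocStencil₂ ((fun κ u κ' u' => dressKBmAt (toSite r) Lc (coProjBmAtK (toSite r) Lc (fun κ₁ u₁ => coProjBmAtK (toSite r) Lc
            ((unitS₂ (sfStep Lc m) (smStep 3 Lc m) (T2RecAt 3 Lc (toSite r) cE cVH cΛ cE₂ cB Tc vh₂S (mixFFAt (toSite r) Lc) m)) κ₁ u₁) κ' u') κ u)) -
          (unitS₂ (sfStep Lc m) (smStep 3 Lc m) (T2RecAt 3 Lc (toSite r) cE cVH cΛ cE₂ cB Tc vh₂S (mixFFAt (toSite r) Lc) m))) CY δY) (hδY : 0 < δY)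
    (hYr : ∀ m : ℕ, LocStencil₂ (((fun κ u κ' u' => dressKBmAt (toSite r) Lc (coProjBmAtK (toSite r) Lc (fun κ₁ u₁ => coProjBmAtK (toSite r) Lc
            ((unitS₂ (sfStep Lc (m + 1)) (smStep 3 Lc (m + 1)) (T2RecAt 3 Lc (toSite r) cE cVH cΛ cE₂ cB Tc vh₂S (mixFFAt (toSite r) Lc) (m + 1))) κ₁ u₁) κ' u') κ u)) -
          (unitS₂ (sfStep Lc (m + 1)) (smStep 3 Lc (m + 1)) (T2RecAt 3 Lc (toSite r) cE cVH cΛ cE₂ cB Tc vh₂S (mixFFAt (toSite r) Lc) (m + 1)))) -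
      ((fun κ u κ' u' => dressKBmAt (toSite r) Lc (coProjBmAtK (toSite r) Lc (fun κ₁ u₁ => coProjBmAtK (toSite r) Lc
            ((unitS₂ (sfStep Lc m) (smStep 3 Lc m) (T2RecAt 3 Lc (toSite r) cE cVH cΛ cE₂ cB Tc vh₂S (mixFFAt (toSite r) Lc) m)) κ₁ u₁) κ' u') κ u)) -
          (unitS₂ (sfStep Lc m) (smStep 3 Lc m) (T2RecAt 3 Lc (toSite r) cE cVH cΛ cE₂ cB Tc vh₂S (mixFFAt (toSite r) Lc) m)))) (CY' * θY ^ m) δY') (hθY0 : 0 ≤ θY) (hθY1 : θY < 1) (hδY' : 0 < δY') (μ ν : Fin 4) :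
    ∃ κ θ : ℝ, 0 ≤ θ ∧ θ < 1 ∧ AllScalesSeq (fun j => B12Beta.secondMoment (TbalOf Lc (JsRowD1Pin hodd N) j) μ ν) κ θ := by
  have hLc3 : 3 ≤ Lc := by
    rcases hodd with ⟨m, hm⟩
    omega
  exact exists_allScalesSeq_JsRowD1Pin_of_wilsonFace_C_QD hodd hLc N hρ hcE hcVH hcΛ hcE₂ hcB hTc hvh
    (fun k γ α β => WilsonThreeFaceGraded.threeFace_wilsonA_of_graded hLc3 k γ α β (hG γ α β))
    hC hY hδY hYr hθY0 hθY1 hδY' μ ν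

end Literal

end Summit.QuantumFields.BalabanUV.Beta.GAN24.ThreeFaceRecLiteral

end
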